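import Summits.BirchSwinnertonDyer.BirchSwinnertonDyer.Theorems.GenusKolyvaginAtTwoGenusPrimitiveSupplyAtTwoTwistLocalConditionPlaces
import Summits.BirchSwinnertonDyer.BirchSwinnertonDyer.Theorems.GenusKolyvaginAtTwoGenusPrimitiveSupplyAtTwoSelmerTransferDown
import HarnessLib

/-!
# Route `GenusKolyvaginAtTwo`, crux #2 `GenusPrimitiveSupplyAtTwo` (stmt-BirchSwinnertonDyer-22136):
# the `2`-Selmer group of a quadratic twist DROPS BY ONE at a transverse, non-strict twisting prime —
# Mazur–Rubin Cor. 3.4 (i) DOWN for `(E, E^{(d)})`, assembled from the local rows, modulo Poitou–Tate, Tate's χ and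
# the transversality at the ramified prime (MR Lemma 2.11) as displayed hypotheses

Width seat `bsd-line-gk2-p5` g8 (cell `bsd-f1-sign2`, SUPPLY lineage), fifth file of the series (crux workfile
`Lines/genus-supply-mr-instantiation.md`). THEOREMS ONLY (no definition, no named fact, no `sorry`); helper
`--supports stmt-BirchSwinnertonDyer-22136`; no item is closed; BSD is not proved by any of this.

WHAT. `natCard_selmerGroup_twist_mul_two_eq_of_local`: over a number field `K`, for `W` elliptic and ANY curve `Wd` with
inverse `Γ_K`-intertwining maps `φ : Wd[2] ⇄ W[2] : ψ` whose transported local Kummer conditions AGREE with those of `W` at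
every `K`-field where `d` is a square (hypothesis `hsplit` — for a model of the twist `W^{(d)}` and THE untwisting `φ` this is
`exists_intertwining_map_kummerLocalConditionAt_eq_of_sq`, p619414, restated here as `exists_intertwining_hsplit` in the
`((2 : ℕ) : ℤ)` currency of X11b), and one finite place `v₀ ∤ 2` such that EVERY other place is (split: `d ∈ (K_v^×)²`) OR (good
for both, `v ∤ 2`: Lemma 2.10 (v), X11b) OR (finite, `v ∤ 2`, no `K_v`-rational `2`-torsion on either: Lemma 2.10 (ii), p619918) OR
(infinite with `H¹(K_w, W) = H¹(K_w, Wd) = 0`: Lemma 2.10 (iv), p619918/gk2-p3), while at `v₀`: the transported condition is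
TRANSVERSE to `W`'s (`htr` — Mazur–Rubin Lemma 2.11, NOT in the tree, displayed), `#W(K_{v₀})[2] = 2`, and `Sel₂(W)` has a class
with non-zero localisation (NOT strict) — THEN **`#Sel₂(Wd) · 2 = #Sel₂(W)`**, granted the print facts
`poitouTate_selmerStructure_duality_real K` and `localEulerPoincareCharacteristic K_v` (hypotheses, X11b style). For the cell:
`K = ℚ`, `Δ(W) < 0`, `d = ℓ* = −ℓ` at a Kolyvagin prime `ℓ ≡ 7 (8)` with `(−ℓ/p) = 1` for `p ∣ N` — every place `≠ ℓ` is split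
(2, bad primes), good-unramified, or `∞` with `Δ < 0`; this is the DOWN half of `MazurRubin2010.cor34i_singleton_rat` that gk2-p4's
capstone and g6/g7's supply consume, now modulo {PT, Tate χ, Lemma 2.11} instead.

References: [MazurRubin2010] Lemmas 2.2, 2.10, 2.11, Def. 3.1, Prop. 3.3, Cor. 3.4 (i); [MilneADT2006] I Thm. 2.8, Lemma 3.3, Thm. 4.10.
-/

set_option linter.dupNamespace false -- tree convention: `Summit.BirchSwinnertonDyer.BirchSwinnertonDyer.Theorems` (summit = sub-problem)
set_option autoImplicit false

noncomputable section

open scoped Classical ContRepresentation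

namespace Summit.BirchSwinnertonDyer.BirchSwinnertonDyer.Theorems.GenusKolyTwistLocal

open WeierstrassCurve Field NumberField IsDedekindDomain Function
open Literature.NumberTheory.EllipticCurves Literature.NumberTheory.GaloisRepresentations
open Literature.NumberTheory.GaloisRepresentations.DiscreteGaloisModule (SelmerStructure)
open Literature.NumberTheory.GaloisCohomology
open Summit.BirchSwinnertonDyer.Rank1Residual.X11b.CongruentTransfer

/-! ## §13 The twist pair in X11b's `((2 : ℕ) : ℤ)` currency -/

section Currency

universe u

variable {K : Type u} [Field K] [NeZero (2 : K)]

/-- `exists_intertwining_map_kummerLocalConditionAt_eq_of_sq` restated with the level written `((2 : ℕ) : ℤ)`, the spelling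
of X11b's prime-level transfer (`CongruentTransfer.*` at `p = 2`). [cite: MazurRubin2010, Lemma 2.10 (i) and Remark 2.4] -/
theorem exists_intertwining_hsplit (W : WeierstrassCurve K) {d : K} (hd : d ≠ 0)
    {Wd : WeierstrassCurve K} {C : VariableChange K} (hWd : C • W.quadraticTwist d = Wd) :
    ∃ (φ : (Wd.torsionGaloisModule ((2 : ℕ) : ℤ)).toContRepresentation →ⁱL
        (W.torsionGaloisModule ((2 : ℕ) : ℤ)).toContRepresentation)
      (φ' : (W.torsionGaloisModule ((2 : ℕ) : ℤ)).toContRepresentation →ⁱL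
        (Wd.torsionGaloisModule ((2 : ℕ) : ℤ)).toContRepresentation),
      (∀ a, φ' (φ a) = a) ∧ (∀ b, φ (φ' b) = b) ∧
      ∀ (E : Type u) [Field E] [Algebra K E], (∃ s : E, s ^ 2 = algebraMap K E d) →
        (Wd.kummerLocalConditionAt ((2 : ℕ) : ℤ) E).map
            (galoisCohomology.map (φ.restrictField E) 1) =
          W.kummerLocalConditionAt ((2 : ℕ) : ℤ) E :=
  exists_intertwining_map_kummerLocalConditionAt_eq_of_sq W hd hWd

end Currency

/-! ## §14 `#Sel₂(Wd) · 2 = #Sel₂(W)` from the local rows -/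

section Twist

variable {K : Type} [Field K] [NumberField K] (W Wd : WeierstrassCurve K) [W.IsElliptic] [Wd.IsElliptic] (d : K)

/-- **The `2`-Selmer group of a twist partner drops by one at a transverse, non-strict place** (Mazur–Rubin Cor. 3.4 (i),
DOWN direction, assembled). HYPOTHESES: print facts `hPT`, `hEP`; inverse intertwining `φ, ψ` between `Wd[2]` and `W[2]` with
the split-place agreement `hsplit` (`exists_intertwining_hsplit` for a twist model); a finite `v₀ ∤ 2` with `#W(K_{v₀})[2] = 2`,
transversality `htr` of the transported condition of `Wd` to that of `W` at `v₀` (MR Lemma 2.11 — displayed, not in the tree) and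
a Selmer class of `W` not strict at `v₀`; and the place-by-place menu `hfin` / `hinf` at every other place (split ∨ both good
`∤ 2` ∨ no rational `2`-torsion `∤ 2`; split ∨ `H¹(K_w, ·) = 0` for both). CONCLUSION: `#Sel₂(Wd) · 2 = #Sel₂(W)`.
[cite: MazurRubin2010, Prop. 3.3 and Cor. 3.4 (i)] [cite: MilneADT2006, Ch. I, Thm. 4.10] -/
theorem natCard_selmerGroup_twist_mul_two_eq_of_local
    (hPT : poitouTate_selmerStructure_duality_real K)
    (hEP : ∀ v : HeightOneSpectrum (𝓞 K), localEulerPoincareCharacteristic (v.adicCompletion K))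
    (φ : (Wd.torsionGaloisModule ((2 : ℕ) : ℤ)).toContRepresentation →ⁱL
      (W.torsionGaloisModule ((2 : ℕ) : ℤ)).toContRepresentation)
    (ψ : (W.torsionGaloisModule ((2 : ℕ) : ℤ)).toContRepresentation →ⁱL
      (Wd.torsionGaloisModule ((2 : ℕ) : ℤ)).toContRepresentation)
    (hψφ : ∀ a, ψ (φ a) = a) (hφψ : ∀ b, φ (ψ b) = b)
    (hsplit : ∀ (E : Type) [Field E] [Algebra K E], (∃ s : E, s ^ 2 = algebraMap K E d) →
      (Wd.kummerLocalConditionAt ((2 : ℕ) : ℤ) E).map (galoisCohomology.map (φ.restrictField E) 1) =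
        W.kummerLocalConditionAt ((2 : ℕ) : ℤ) E)
    (v₀ : HeightOneSpectrum (𝓞 K)) (hv₀ : ((2 : ℕ) : 𝓞 K) ∉ v₀.asIdeal)
    (hfin : ∀ v : HeightOneSpectrum (𝓞 K), v ≠ v₀ →
      (∃ s : v.adicCompletion K, s ^ 2 = algebraMap K (v.adicCompletion K) d) ∨
      (((2 : ℕ) : 𝓞 K) ∉ v.asIdeal ∧ W.HasGoodReductionAt v ∧ Wd.HasGoodReductionAt v) ∨
      (((2 : ℕ) : 𝓞 K) ∉ v.asIdeal ∧
        Nat.card (nsmulAddMonoidHom 2 : (W.baseChange (v.adicCompletion K)).toAffine.Point →+ _).ker = 1 ∧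
        Nat.card (nsmulAddMonoidHom 2 : (Wd.baseChange (v.adicCompletion K)).toAffine.Point →+ _).ker = 1))
    (hinf : ∀ w : InfinitePlace K,
      (∃ s : w.Completion, s ^ 2 = algebraMap K w.Completion d) ∨
      ((∀ x : galoisCohomology (W.localGaloisModule w.Completion) 1, x = 0) ∧
        (∀ x : galoisCohomology (Wd.localGaloisModule w.Completion) 1, x = 0)))
    (htr : (Wd.kummerLocalConditionAt ((2 : ℕ) : ℤ) (v₀.adicCompletion K)).map
        (galoisCohomology.map (φ.restrictField (v₀.adicCompletion K)) 1) ⊓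
      W.kummerLocalConditionAt ((2 : ℕ) : ℤ) (v₀.adicCompletion K) = ⊥)
    (ht : Nat.card (nsmulAddMonoidHom 2 : (W.baseChange (v₀.adicCompletion K)).toAffine.Point →+ _).ker = 2)
    (hns : ∃ c ∈ (W.kummerSelmerStructure ((2 : ℕ) : ℤ)).selmerGroup,
      galoisCohomology.localization (W.torsionGaloisModule ((2 : ℕ) : ℤ)) (Sum.inr v₀) 1 c ≠ 0) :
    Nat.card (Wd.selmerGroup ((2 : ℕ) : ℤ)) * 2 = Nat.card (W.selmerGroup ((2 : ℕ) : ℤ)) := by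
  -- the transported Kummer structure of `Wd`
  let 𝓐 : SelmerStructure (W.torsionGaloisModule ((2 : ℕ) : ℤ)) := fun v ↦
    (Wd.kummerSelmerStructure ((2 : ℕ) : ℤ) v).map
      (galoisCohomology.map (φ.restrictField (Place.Completion v)) 1)
  have h𝓐 : ∀ v, 𝓐 v = (Wd.kummerSelmerStructure ((2 : ℕ) : ℤ) v).map
      (galoisCohomology.map (φ.restrictField (Place.Completion v)) 1) := fun _ ↦ rfl
  refine natCard_selmerGroup_mul_eq_of_transverse_of_localization_ne_zero W Wd 2 hPT hEP φ ψ hψφ hφψ 𝓐 h𝓐 v₀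
    ?_ ?_ ?_ hns
  · -- agreement at every place other than `v₀`
    rintro (w | v) hv
    · rcases hinf w with ⟨s, hs⟩ | ⟨hW, hWd⟩
      · rw [h𝓐, kummerSelmerStructure_apply, kummerSelmerStructure_apply]
        exact hsplit (Place.Completion (Sum.inl w)) ⟨s, hs⟩
      · rw [h𝓐, kummerSelmerStructure_apply, kummerSelmerStructure_apply]
        exact map_kummerLocalConditionAt_eq_of_eq_top W Wd ((2 : ℕ) : ℤ) (Place.Completion (Sum.inl w)) φ ψ hφψ
          (kummerLocalConditionAt_eq_top_of_forall_eq_zero Wd _ _ hWd)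
          (kummerLocalConditionAt_eq_top_of_forall_eq_zero W _ _ hW)
    · have hvv₀ : v ≠ v₀ := fun h ↦ hv (by rw [h])
      rcases hfin v hvv₀ with ⟨s, hs⟩ | ⟨h2v, hvW, hvWd⟩ | ⟨h2v, h1W, h1Wd⟩
      · rw [h𝓐, kummerSelmerStructure_apply, kummerSelmerStructure_apply]
        exact hsplit (Place.Completion (Sum.inr v)) ⟨s, hs⟩
      · exact transport_kummer_inr_eq_of_good W Wd 2 φ ψ hφψ 𝓐 h𝓐 h2v hvW hvWd
      · rw [h𝓐, kummerSelmerStructure_apply, kummerSelmerStructure_apply]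
        exact map_kummerLocalConditionAt_adicCompletion_eq_of_natCard_ker_eq_one W Wd v two_ne_zero h2v h1W h1Wd φ
  · -- transversality at `v₀`
    rw [h𝓐, kummerSelmerStructure_apply, kummerSelmerStructure_apply]
    exact htr
  · -- `t_{v₀} = 2`
    rw [ht, natCard_quotient_span_natCast_eq_one_of_not_mem v₀ hv₀, mul_one]

end Twist

end Summit.BirchSwinnertonDyer.BirchSwinnertonDyer.Theorems.GenusKolyTwistLocal

end
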